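import Mathlib.RepresentationTheory.Homological.GroupCohomology.LongExactSequence
import HarnessLib

/-!
# Endomorphisms vanishing on the cohomology of a coresolution act nilpotently

Topic `Algebra/Homology`; namespace `Literature.Algebra.Homology`.  A *proofs* file (theorems
only, Mathlib only) recording the elementary "dimension-shifting" substitute for the
Hochschild–Serre / hypercohomology spectral sequence that is used to compare Hecke actions at
different levels and coefficients (Scholze, *On torsion in the cohomology of locally symmetric
varieties*, Ann. of Math. 182 (2015), §V.4, proof of Thm. V.4.1: "One has the Hochschild–Serre
spectral sequence … This reduces us to the case that `K` is sufficiently small, and that `ξ` is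
trivial"; Emerton, Invent. Math. 164 (2006), §2.2): an operator acting as zero on the `E₁`/`E₂`
terms of a first-quadrant spectral sequence acts NILPOTENTLY, of order at most `q + 1`, on the
degree-`q` abutment.  We avoid spectral sequences altogether.

For a commutative ring `k` and a group `G` (Mathlib `groupCohomology`, `groupCohomology.map`,
the long exact sequence `groupCohomology.δ`, `groupCohomology.mapShortComplex₁_exact`,
`groupCohomology.δ_naturality`):

* `map_τ₁_zero_eq_zero_of_shortExact`: for a short exact `0 → X₁ → X₂ → X₃ → 0` in `Rep k G`
  with a compatible endomorphism `F`, if `H⁰(F.τ₂) = 0` then `H⁰(F.τ₁) = 0`;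
* `pow_succ_map_τ₁_eq_zero_of_shortExact` (one step of dimension shifting): if `Hʲ(F.τ₂) = 0`
  and `Hⁱ(F.τ₃)^m = 0`, `i + 1 = j`, then `Hʲ(F.τ₁)^(m+1) = 0` — indeed `Hʲ(F.τ₁) x` dies in
  `Hʲ(X₂)`, so is `δ y`, and `Hʲ(F.τ₁)^m (δ y) = δ (Hⁱ(F.τ₃)^m y) = 0`;
* `pow_succ_map_eq_zero_of_coresolution`: for a CORESOLUTION of `Z 0` cut into short exact
  pieces `0 → Z a → W a → Z (a+1) → 0` (`a ≥ 0`) with compatible endomorphisms `φZ a`, `φW a`,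
  if `Hᵇ(φW a) = 0` whenever `a + b ≤ q`, then `Hᵇ(φZ a)^(b+1) = 0` whenever `a + b ≤ q`; in
  particular (`pow_succ_map_eq_zero_of_coresolution_zero`) **`H^q(φZ 0)^(q+1) = 0`**.

Typical use (not formalised here): `Γ` a group, `H` a finite group acting on a `Γ`-module `W`
compatibly, `W` acyclic for `H`; the `H`-cochain coresolution
`0 → W^H → C⁰(H, W) → C¹(H, W) → ⋯` has `Cᵃ(H, W) ≅ W^{Hᵃ}`, so an endomorphism of `W` killing
`Hᵇ(Γ, W)` for `b ≤ q` kills `Hᵇ(Γ, Cᵃ(H, W))` and hence acts on `H^q(Γ, W^H)` with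
`(q+1)`-st power zero — the statement extracted from the Hochschild–Serre spectral sequence
`Hᵃ(H, Hᵇ(Γ, W)) ⇒ H^{a+b}(Γ, W^H)` in [Scholze2015, §V.4, proof of Thm. V.4.1].

Powers are taken in `Module.End k (groupCohomology _ _)` (the `.hom` of the `ModuleCat`
morphisms `groupCohomology.map (MonoidHom.id G) _ _`), the form in which Hecke operators on
cohomology are used in `Literature/NumberTheory/Automorphic`.

## References

* P. Scholze, *On torsion in the cohomology of locally symmetric varieties*, Ann. of Math. 182
  (2015), §V.4, proof of Thm. V.4.1 [Scholze2015].
* M. Emerton, *On the interpolation of systems of eigenvalues attached to automorphic Hecke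
  eigenforms*, Invent. Math. 164 (2006), §2.2 [Emerton2006].
* K. S. Brown, *Cohomology of Groups*, GTM 87 (1982), III §7 (dimension shifting), VII §6
  (Hochschild–Serre) [Brown1982CohomologyGroups].
-/

noncomputable section

open CategoryTheory groupCohomology

universe u

namespace Literature.Algebra.Homology

variable {k G : Type u} [CommRing k] [Group G]

/-! ### One short exact sequence with a compatible endomorphism -/

section OneStep

variable {X : ShortComplex (Rep k G)} (hX : X.ShortExact) (F : X ⟶ X)

include hX in
/-- **Degree `0`.**  For a short exact sequence `0 → X₁ → X₂ → X₃ → 0` of representations with a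
compatible endomorphism `F`, if `H⁰(G, F.τ₂) = 0` then `H⁰(G, F.τ₁) = 0` (`H⁰(X₁) ↪ H⁰(X₂)`).
[folklore] -/
theorem map_τ₁_zero_eq_zero_of_shortExact (h₂ : map (MonoidHom.id G) F.τ₂ 0 = 0) :
    map (MonoidHom.id G) F.τ₁ 0 = 0 := by
  haveI := hX.mono_f
  rw [← cancel_mono (map (MonoidHom.id G) X.f 0), Limits.zero_comp, ← map_id_comp, F.comm₁₂,
    map_id_comp, h₂, Limits.comp_zero]

include hX in
/-- Naturality of the connecting homomorphism with respect to POWERS of a compatible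
endomorphism: `Hʲ(F.τ₁)^m (δ y) = δ (Hⁱ(F.τ₃)^m y)`. [folklore] -/
theorem pow_map_τ₁_δ_apply {i j : ℕ} (hij : i + 1 = j) (m : ℕ) (y : groupCohomology X.X₃ i) :
    ((map (MonoidHom.id G) F.τ₁ j).hom ^ m) ((δ hX i j hij).hom y) =
      (δ hX i j hij).hom (((map (MonoidHom.id G) F.τ₃ i).hom ^ m) y) := by
  induction m with
  | zero => simp
  | succ m ih =>
    have hnat : ∀ z : groupCohomology X.X₃ i,
        (map (MonoidHom.id G) F.τ₁ j).hom ((δ hX i j hij).hom z) =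
          (δ hX i j hij).hom ((map (MonoidHom.id G) F.τ₃ i).hom z) := fun z => by
      have h := congrArg (fun f => f.hom z) (δ_naturality hX hX F i j hij)
      simpa only [ModuleCat.hom_comp, LinearMap.comp_apply] using h
    rw [pow_succ', Module.End.mul_apply, ih, hnat, pow_succ', Module.End.mul_apply]

include hX in
/-- **One step of dimension shifting.**  For a short exact sequence `0 → X₁ → X₂ → X₃ → 0` of
representations with a compatible endomorphism `F` and `i + 1 = j`: if `Hʲ(G, F.τ₂) = 0` and
`Hⁱ(G, F.τ₃)^m = 0`, then `Hʲ(G, F.τ₁)^(m+1) = 0`.  Proof: for `x ∈ Hʲ(X₁)`, `Hʲ(F.τ₁) x` maps to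
`Hʲ(F.τ₂)(x) = 0` in `Hʲ(X₂)`, so equals `δ y` by exactness; then
`Hʲ(F.τ₁)^m (δ y) = δ (Hⁱ(F.τ₃)^m y) = 0`. [cite: Brown1982CohomologyGroups, III §7] -/
theorem pow_succ_map_τ₁_eq_zero_of_shortExact {i j : ℕ} (hij : i + 1 = j) {m : ℕ}
    (h₂ : map (MonoidHom.id G) F.τ₂ j = 0)
    (h₃ : (map (MonoidHom.id G) F.τ₃ i).hom ^ m = 0) :
    (map (MonoidHom.id G) F.τ₁ j).hom ^ (m + 1) = 0 := by
  refine LinearMap.ext fun x => ?_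
  -- `Hʲ(F.τ₁) x` lies in the kernel of `Hʲ(X₁) → Hʲ(X₂)`
  have hker : (map (MonoidHom.id G) X.f j).hom ((map (MonoidHom.id G) F.τ₁ j).hom x) = 0 := by
    rw [← LinearMap.comp_apply, ← ModuleCat.hom_comp, ← map_id_comp, F.comm₁₂, map_id_comp,
      h₂, Limits.comp_zero, ModuleCat.hom_zero, LinearMap.zero_apply]
  -- hence in the image of `δ`
  obtain ⟨y, hy⟩ := (ShortComplex.moduleCat_exact_iff _).1 (mapShortComplex₁_exact hX hij)
    ((map (MonoidHom.id G) F.τ₁ j).hom x) hker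
  change (δ hX i j hij).hom y = (map (MonoidHom.id G) F.τ₁ j).hom x at hy
  rw [pow_succ, Module.End.mul_apply, ← hy, pow_map_τ₁_δ_apply hX F hij m y, h₃,
    LinearMap.zero_apply, map_zero, LinearMap.zero_apply]

end OneStep

/-! ### Coresolutions -/

section Coresolution

variable (Z W : ℕ → Rep k G) (ι : ∀ a, Z a ⟶ W a) (π : ∀ a, W a ⟶ Z (a + 1))
  (w : ∀ a, ι a ≫ π a = 0) (hex : ∀ a, (ShortComplex.mk (ι a) (π a) (w a)).ShortExact)
  (φZ : ∀ a, Z a ⟶ Z a) (φW : ∀ a, W a ⟶ W a)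
  (hι : ∀ a, φZ a ≫ ι a = ι a ≫ φW a) (hπ : ∀ a, φW a ≫ π a = π a ≫ φZ (a + 1))

include hex hι hπ in
/-- **Nilpotence propagation along a coresolution.**  Let `Z 0 → W 0 → W 1 → ⋯` be a coresolution
in `Rep k G` presented by short exact pieces `0 → Z a → W a → Z (a+1) → 0`, and let `φZ a`, `φW a`
be endomorphisms compatible with all the maps.  If `Hᵇ(G, φW a) = 0` whenever `a + b ≤ q`, then
`Hᵇ(G, φZ a)^(b+1) = 0` whenever `a + b ≤ q` (induction on `b` by
`pow_succ_map_τ₁_eq_zero_of_shortExact`).  This is what the Hochschild–Serre / hypercohomology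
spectral sequence argument of [cite: Scholze2015, §V.4, proof of Thm. V.4.1] extracts: operators
vanishing on the `E₁`-terms act nilpotently on the abutment. -/
theorem pow_succ_map_eq_zero_of_coresolution (q : ℕ)
    (hW : ∀ a b, a + b ≤ q → map (MonoidHom.id G) (φW a) b = 0) :
    ∀ b a, a + b ≤ q → (map (MonoidHom.id G) (φZ a) b).hom ^ (b + 1) = 0 := by
  intro b
  induction b with
  | zero =>
    intro a ha
    have h := map_τ₁_zero_eq_zero_of_shortExact (hex a)
      (⟨φZ a, φW a, φZ (a + 1), hι a, hπ a⟩ : ShortComplex.mk (ι a) (π a) (w a) ⟶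
        ShortComplex.mk (ι a) (π a) (w a)) (hW a 0 ha)
    change map (MonoidHom.id G) (φZ a) 0 = 0 at h
    rw [zero_add, pow_one, h, ModuleCat.hom_zero]
  | succ b ih =>
    intro a ha
    exact pow_succ_map_τ₁_eq_zero_of_shortExact (hex a)
      (⟨φZ a, φW a, φZ (a + 1), hι a, hπ a⟩ : ShortComplex.mk (ι a) (π a) (w a) ⟶
        ShortComplex.mk (ι a) (π a) (w a)) rfl (hW a (b + 1) ha) (ih (a + 1) (by omega))

include hex hι hπ in
/-- **Corollary (the abutment).**  Under the hypotheses of `pow_succ_map_eq_zero_of_coresolution`,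
`H^q(G, φZ 0)^(q+1) = 0` on `H^q(G, Z 0)`. [cite: Scholze2015, §V.4, proof of Thm. V.4.1] -/
theorem pow_succ_map_eq_zero_of_coresolution_zero (q : ℕ)
    (hW : ∀ a b, a + b ≤ q → map (MonoidHom.id G) (φW a) b = 0) :
    (map (MonoidHom.id G) (φZ 0) q).hom ^ (q + 1) = 0 :=
  pow_succ_map_eq_zero_of_coresolution Z W ι π w hex φZ φW hι hπ q hW q 0 (by omega)

end Coresolution

end Literature.Algebra.Homology
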